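import Literature.MathematicalPhysics.QuantumFieldTheory.Balaban1983to89.B8SockP5uEAssembly
import Literature.MathematicalPhysics.QuantumFieldTheory.Balaban1983to89.B8Prop5UniqSectEW

/-!
# `Balaban1983to89.B8SockP5uEAssemblyB` — [Balaban1985RegularSpaces] Prop. 5 (1.109) p. 94 with Thm 4 p. 88/p. 95: THE PROVIDER of the repaired
# Proposition-5 UNIQUENESS socket `SockP5uE` FROM THE GUARDED UNIQUENESS-LETTERS FAMILY — `pub-ymgap-dag-n04-b`'s `B8SockP5uEAssembly`
# (`sockP5uE_body_of_join'`, `sockP5uE_of_lettersU`, `exists_threshold_sockP5uE`) re-run with [4]'s left-inverse law of `G′` asked on bounded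
# functions only (W8″), over the engine `B8Prop5UniqSectEW`

statement-level skeleton of published theorems with citation tags; proofs where landed; nothing here is a claim about the
Yang–Mills mass gap

PDF held: `paper:balaban1985-cmp99-regular-spaces-gauge-fixing` (journal page = PDF page + 74); p. 88 (Thm 4), p. 94 (Prop. 5 (1.107)–(1.109)), p. 95
(the uniqueness paragraph of Theorem 4).  [4] = [Balaban1985BackgroundPropagators], Thm 3.1 p. 397.

WHY THIS FILE (cell `pub-ymgap`, HUMAN RULING D-0062; R134 acceleration seat `pub-ymgap-dag-n05-d` (g3); (L2) of this seat's g2 LOCATED list).  The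
uniqueness-letters family `SLetU` read by n04-b's `exists_threshold_sockP5uE` and by the N05 knits `B8LeafKnitZd3LettersRD.…_lettersRDU` displays
`G′` through the TOTAL left-inverse law `∀ x, G′(Δx + Q′ᵀ𝔄Q′x) = x` on all functions `ℤᵈ → 𝔸`; at the `Ω 0 = univ` members of record the readings pin
`Δ′ = Δ + Q′ᵀ𝔄Q′` everywhere and the `Lᵏ`-periodic finite-range `Δ′` has unbounded null vectors, so the family is VACUOUS there (INBOX W8″; dag-ref-A
READ-24 (4)).  Print's `G′` is `(Δ′_{Ω₀})⁻¹` on functions on `Ω₀` in weighted sup norms ([4] Thm 3.1 p. 397), i.e. the law holds for BOUNDED `x`.  THIS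
FILE re-runs n04-b's provider on the guarded engine: **`sockP5uE_body_of_join_b`** (the body, α₄ free), **`sockP5uE_of_lettersUB`** (the socket at one
member), **`exists_threshold_sockP5uEB`** (one radius, one threshold) — signatures = n04-b's with conjunct 1 of the letters family guarded; the socket
`B8LeafModelZdSockP5uE.SockP5uE` itself (owner `pub-ymgap-dag-n05-a`) is untouched, so every consumer keys unchanged.  Consumer:
`B8LeafKnitZd3LettersRDB` (the N05 knits with the guarded family).

HONEST SCOPE.  Plumbing by name over landed modules with one displayed law WEAKENED to its printed domain; nothing of [4]'s letters (hypotheses),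
of [4] Thm 3.3 (the b9 socket is a hypothesis), of Sect. E or of the contraction is proved here beyond composition; windows displayed, not
discharged.  Count-neutral; N05 NOT discharged; one finite T⁴ programme at fixed ε; nothing continuum / ℝ⁴ / OS / mass-gap / Clay.  Unit
`pub-ymgap-dag-n05-d` (g3), 2026-08-27.
-/

noncomputable section

open NormedSpace
open scoped BigOperators

namespace Literature.MathematicalPhysics.QuantumFieldTheory.Balaban1983to89.B8SockP5uEAssemblyB

open Complex (I)
open B7Prop1Explicit B7Prop2Explicit B7Prop1Local B7Eq92Concrete
open B7Prop2Explicit (C0 c2')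
open B7Prop3Flat (c3)
open B7Prop10General (C6 C4G)
open B7Prop9Flat (C5')
open B7Eq78Linearization (conjR zdBlocking QprimeIter)
open B7Eq167Flat (InLambda)
open B8Ineq132 (covDerivFwd covDeriv InAk norm_conjR)
open B8Eq119TwistedAxial (Restr129 InAx bgT)
open B8Eq184Proof (gaugeExp cfgExp)
open B8Eq182Proof (gAd)
open B8Eq188Proof (frakF3)
open B8Lemma1NonAbelian (mulCfg)
open B8Eq140Level (SideTouches sideTouches_mono)
open B8Eq146AExpansion (iEta expCfg)
open B8Ineq130 (tlo thi)
open B8Thm2LogB (blockTop)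
open B8Eq138LandauZd (IsLandau138W covDivB covLap QT logCfg)
open B8Ineq125Concrete (C2p)
open B8Eq1117Concrete (XSpace)
open B8Eq1117KLevel (glev_on_towers_of_axial)
open B8SectEInLambdaWitness (witness_unitary_of_glev)
open B8Prop3GaugeFixedKLevel (expCfg_iEta_eq_cfgExp logField_spec mem_unitaryUnits_of_mgauge_eq)
open B8Eq155JBound (expCfg_iEta_mem_unitaryUnits)
open B8Thm4AtLandau138 (mgauge_mgauge_inv)
open B8Thm4Concrete (mulCfg_eq_mul)
open B8LeafModelZd3 (SockB9P3)
open B8Prop5ContractionKLevel (Bd2 Mc Kc)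
open B8LambdaSpaceKLevel (wt wt_nonneg)
open B8Prop5GaugeParamKLevel (norm_covDeriv_eq)
open B8Prop5KLevelLetters (covDivB_logCfg_gaugeFixed)
open B8Prop5SocketDatum (exists_masked_datum grad_bound_of_datum bd2_covDivB_of_grad sideTouches_pair_of_mem sideTouches_of_tower_bond
  h33_of_inAk hP_of_datum h69_of_datum hA_of_datum)
open B8Prop5UniqSectEW (hFP_unique_of_sectE_local_wb)

-- `Site` alone could resolve to the torus sites of `Setup.lean`; re-export the `ℤ^d` sites of `B7Prop1Explicit`.
export B7Prop1Explicit (Site)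

variable {d : ℕ} {𝔸 : Type*} [CStarAlgebra 𝔸] [Nontrivial 𝔸]

/-! ## §1 The provider body of the repaired uniqueness socket at one datum, guarded left inverse, radius `α₄` free -/

/-- **THE PROVIDER BODY OF `SockP5uE` WITH THE LEFT-INVERSE LAW OF `G′` ON BOUNDED FUNCTIONS** — n04-b's `B8SockP5uEAssembly.sockP5uE_body_of_join'`
(contraction radius `α₄` free, print p. 94 «largest possible α₄ … independent of α₀ + α₁») VERBATIM except: the letters binder `g_left` is
re-typed `g_leftB : ∀ x, (∃ C, ∀ y, ‖x y‖ ≤ C) → G′(Δx + Q′ᵀ𝔄Q′x) = x` ([Balaban1985BackgroundPropagators] Thm 3.1 p. 397: `G′ = (Δ′_{Ω₀})⁻¹` on bounded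
functions; the total law has no model on `ℤᵈ → 𝔸` at `Ω 0 = univ`, INBOX W8″), and the engine is `B8Prop5UniqSectEW.hFP_unique_of_sectE_local_wb`
(uniqueness JOIN at print's generality) fed by the UNITARY Λ_j-WITNESSES of Theorem 4's inductive `u₁`
(`B8SectEInLambdaWitness.witness_unitary_of_glev ∘ B8Eq1117KLevel.glev_on_towers_of_axial`, class constant `α₃ = 40d·c_B`).  Setting, datum
dictionary (`B8Prop5SocketDatum`), windows and CLAIM (two competitors of `SockP5uE`'s shape coincide) byte-identical to n04-b's.
[cite: Balaban1985RegularSpaces, Prop. 5 (1.109) p.94, Thm 4 p.88, p.95 (uniqueness paragraph), (1.67)–(1.69) p.88, (1.86)–(1.88) p.91, (1.112) p.95; Balaban1985Averaging, (106) p.33, (166)–(167) p.44; Balaban1985BackgroundPropagators, Thm 3.1 p.397, Thm 3.3 p.398] -/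
theorem sockP5uE_body_of_join_b (hd2 : 2 ≤ d) {L : ℕ} (hL : 2 ≤ L) {η : ℝ} (hη : 0 < η) {k : ℕ} (hk : 1 ≤ k)
    -- the member's geometry (`Ω 0 = univ` sub-family)
    {Ω : ℕ → Set (Site d)} (hΩ : ∀ j, Ω (j + 1) ⊆ Ω j) (hΩ0 : Ω 0 = Set.univ) {Λs : ℕ → ℕ → Set (Site d)} {Λb : ℕ → ℕ → Set (Site d × Fin d)}
    (hbox : ∀ m, m ≤ k → ∀ j, j ≤ m → ∀ c ∈ Λb m j, ∀ x, InBox (loK L j c.1) (bondHiK L j c.1 c.2) x → x ∈ Ω j)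
    (hclass : ∀ m, m ≤ k → ∀ j, j ≤ m → ∀ c ∈ Λb m j,
      (c.1 ∈ Λs m j ∧ c.1 + e c.2 ∈ Λs m j) ∨
      (∃ j', j = j' + 1 ∧ (∀ x, (L : ℤ) • c.1 ≤ x → x ≤ (L : ℤ) • c.1 + blockTop L → x ∈ Λs m j') ∧ c.1 + e c.2 ∈ Λs m j) ∨
      (∃ j', j = j' + 1 ∧ c.1 ∈ Λs m j ∧ (∀ x, (L : ℤ) • (c.1 + e c.2) ≤ x → x ≤ (L : ℤ) • (c.1 + e c.2) + blockTop L → x ∈ Λs m j')))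
    (htower : ∀ j, j ≤ k → ∀ y ∈ Λs k j, ∀ x, InBox (tlo L y j) (thi L y j) x → x ∈ Ω j)
    -- the socket's antecedents: constants, (1.33), (1.34), (1.35)
    {α₀ α₁ B₀ cs α₄ cu : ℝ} (hα₀ : 0 < α₀) (hα₁ : 0 < α₁) (hB₀ : 0 < B₀)
    (hcs : cs = 5 * (d : ℝ) * L * B₀ * (α₀ + α₁)) (hα₄ : 0 < α₄)
    {U₀ U' : Site d → Fin d → 𝔸ˣ} (hU₀ : ∀ x κ, U₀ x κ ∈ unitaryUnits 𝔸) (hU' : ∀ x κ, U' x κ ∈ unitaryUnits 𝔸)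
    (h33 : InAk L k η α₀ Ω U₀) (h34 : InAk L k η α₀ Ω (mulCfg U' U₀)) (hAx : ∀ m', m' ≤ k → InAx L m' (Λs m') U₀ (mulCfg U' U₀))
    (h135 : ∀ j, j ≤ k → ∀ (z : Site d) (μ : Fin d), (∀ x, InBox (loK L j z) (bondHiK L j z μ) x → x ∈ Ω j) →
      ‖(avgIter L (mulCfg U' U₀) j z μ : 𝔸) - (avgIter L U₀ j z μ : 𝔸)‖ ≤ α₁)
    -- the datum of Theorem 4's uniqueness paragraph: `u₁` with (1.29), (1.38) and the (1.62)-shape for `U₁ = U′^{u₁⁻¹}`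
    {u₁ : Site d → 𝔸ˣ} (hu₁ : ∀ x, u₁ x ∈ unitaryUnits 𝔸) (h129 : Restr129 L k (Λs k) U₀ u₁)
    (hLan : IsLandau138W L k η (Ω 0) (Λs k) U₀ (mgauge U₀ u₁⁻¹ U'))
    (hdat : ∃ A₁ : Site d → Fin d → 𝔸, ∀ j, j ≤ k → ∀ (x : Site d) (κ : Fin d), SideTouches (Ω j) x κ →
      mgauge U₀ u₁⁻¹ U' x κ = cfgExp η A₁ x κ ∧ ‖A₁ x κ‖ ≤ cs * ((L : ℝ) ^ j * η)⁻¹)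
    -- the b9 socket in Proposition 3's frame AT THE TOP LEVEL `k`, and its threshold
    {B₀β cB9 β : ℝ} {len : Site d → ℝ} (SB9 : SockB9P3 (𝔸 := 𝔸) L B₀ B₀β cB9 β len η k Ω Λs Λb)
    (hα₀9 : α₀ ≤ cB9) (hcs9 : cs ≤ cB9)
    -- Proposition 3's windows at `(α₀, α₂ := c⋆)` not implied by the JOIN's
    {C₂ : ℝ} (hside : 36 * d * B₀ * cs ≤ 1 / 2)
    (hC₂ : 8 * (131072 * ((d : ℝ) + 1) ^ 2) * Real.exp (4 * (800 * ((d : ℝ) + 1) ^ 2 * ((d : ℝ) + 4)) * α₀) ≤ C₂)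
    (h61 : 2 * cs ^ 2 + 20 * d * α₀ * cs + 2 * C₂ * cs ^ 2 ≤ α₀ + α₁) (hsmall₁ : (d : ℝ) * L * α₁ ≤ 1 / 8)
    -- the [4] LETTERS at `(k, U₀)`, with the uniqueness laws
    (g Δ : (Site d → 𝔸) →ₗ[ℂ] (Site d → 𝔸)) (q : (Site d → 𝔸) →ₗ[ℂ] (ℕ → Site d → 𝔸)) (qs : (ℕ → Site d → 𝔸) →ₗ[ℂ] (Site d → 𝔸))
    (Aw c : (ℕ → Site d → 𝔸) →ₗ[ℂ] (ℕ → Site d → 𝔸))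
    (g_leftB : ∀ x : Site d → 𝔸, (∃ C : ℝ, ∀ y, ‖x y‖ ≤ C) → g (Δ x + qs (Aw (q x))) = x)
    (c_left' : ∀ φ, qs (c (q (g (g (qs φ))))) = qs φ)
    (hΔ : ∀ (f : Site d → 𝔸), ∀ x ∈ Ω 0, Δ f x = covLap η U₀ ((Ω 0).indicator f) x)
    (hqs : ∀ (μ : ℕ → Site d → 𝔸), ∀ x ∈ Ω 0, qs μ x = QT L k (Λs k) U₀ μ x)
    (hq : ∀ (f : Site d → 𝔸) (j : ℕ), j ≤ k → ∀ y ∈ Λs k j, q f j y = QprimeIter (zdBlocking d L) (bgT L U₀) j f y)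
    (hq0 : ∀ (f : Site d → 𝔸) (j : ℕ) (y : Site d), ¬ (j ≤ k ∧ y ∈ Λs k j) → q f j y = 0)
    (H' : XSpace d k 𝔸 →ₗ[ℂ] (Site d → 𝔸)) {B₀'H B₂' BG BR : ℝ} (hB₀'H : 0 < B₀'H) (hB₂' : 0 ≤ B₂') (hBG : 0 ≤ BG) (hBR : 0 ≤ BR)
    (hH0 : ∀ (X : XSpace d k 𝔸) (x : Site d), ‖H' X x‖ ≤ B₀'H * ‖X‖)
    (hH1 : ∀ j, j ≤ k → ∀ (X : XSpace d k 𝔸), ∀ p ∈ {b : Site d × Fin d | SideTouches (Ω j) b.1 b.2},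
      wt L η j * ‖covDerivFwd η U₀ p.2 (H' X) p.1‖ ≤ B₀'H * ‖X‖)
    (hH2 : ∀ X : XSpace d k 𝔸, Bd2 L η k Ω (covLap η U₀ (H' X)) (B₂' * ‖X‖))
    (hQH : ∀ (Y : XSpace d k 𝔸) (j : ℕ) (hj : j ≤ k) (y : Site d), y ∈ Λs k j →
      QprimeIter (zdBlocking d L) (bgT L U₀) j (H' Y) y = Y (⟨j, Nat.lt_succ_of_le hj⟩, y))
    (hG : ∀ (f : Site d → 𝔸) (r : ℝ), 0 ≤ r → Bd2 L η k Ω f r →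
      (∀ x, ‖g f x‖ ≤ BG * r) ∧ ∀ j, j ≤ k → ∀ p ∈ {b : Site d × Fin d | SideTouches (Ω j) b.1 b.2},
        wt L η j * ‖covDerivFwd η U₀ p.2 (g f) p.1‖ ≤ BG * r)
    (hRbd : ∀ (f : Site d → 𝔸) (r : ℝ), 0 ≤ r → Bd2 L η k Ω f r → Bd2 L η k Ω (f - g (qs (c (q (g f))))) (BR * r))
    -- the JOIN's scalar windows, one-for-one (`αP := α₀`, `α₄` free; `cB cA cDA` free above their datum values)
    {cB cA cDA : ℝ} (hcBlo : L * cs ≤ cB) (hcAlo : L * cs ≤ cA) (hcDAlo : (d : ℝ) * (L : ℝ) ^ 2 * cs ≤ cDA)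
    (hα3 : C0 d * α₀ ≤ 1 / 3) (hα4 : 4 * α₀ ≤ c2' d L)
    (hsmall : Real.exp (4 * (800 * ((d : ℝ) + 1) ^ 2 * ((d : ℝ) + 4)) * α₀) * (1 + 8 * (131072 * ((d : ℝ) + 1) ^ 2) * cB) ≤ 2)
    (hc₃ : 2 * cB ≤ c3 d L) (hsc : 2048 * (d : ℝ) * cB ≤ 1) (hα₃' : 40 * d * cB ≤ 1 / 200)
    (hs₁ : 200 * C6 d * (2 * α₄) ≤ 1) (hs₂ : 12000 * ((d : ℝ) + 1) * L * (2 * α₄) ≤ 1)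
    (hs₃ : C4G d L * (α₀ + 40 * d * cB + 4 * (2 * α₄)) ≤ 1)
    (hs₄ : 1024 * ((d : ℝ) + 1) * ((d : ℝ) + 4) * L ^ 2 * α₀ ≤ 1) (hs₅ : 32 * ((d : ℝ) + 1) ^ 2 * C6 d * L ^ 2 * α₀ ≤ 1)
    (hs₆ : 16 * d * C5' d * C6 d * (L : ℝ) ^ 2 * α₀ ≤ 1) (hs₇ : 8 * d * C6 d * L * α₀ ≤ 1)
    (hsm : 40 * d * cB + α₄ ≤ 1 / (4 * B₀'H * (2 * C2p d))) (hprod8 : 2 * C6 d * (40 * d * cB + 4 * α₄) ≤ 1 / 8)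
    {hE hE₂ lE lE₂ : ℝ} (hE_def : hE = B₀'H * (C2p d * (40 * d * cB + α₄) * α₄)) (hE₂_def : hE₂ = B₂' * (C2p d * (40 * d * cB + α₄) * α₄))
    (lE_def : lE = B₀'H * (4 * C2p d * (40 * d * cB + 2 * α₄))) (lE₂_def : lE₂ = B₂' * (4 * C2p d * (40 * d * cB + 2 * α₄)))
    (hcA' : cA ≤ 1 / 13) (ha₁' : α₄ / 4 + hE ≤ 1 / 24) (hb₁' : α₄ / 4 + hE ≤ 1 / 140) (hθ : 10 * (α₄ / 4 + hE) * BR ≤ 1 / 2)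
    (h103 : BG * Mc d BR (α₄ / 4 + hE) cA hE₂ cDA ≤ α₄ / 4)
    (h106 : BG * Kc d BR (α₄ / 4 + hE) cA hE₂ cDA lE₂ (1 + lE) (1 + lE) ≤ 1 / 2)
    -- the two uniqueness windows: Lipschitz modulus of `H_c`, and the radius `c_u` of (1.109) against the ¼α₄-ball
    (hlE : lE ≤ 1 / 2) (hcu : cu + hE ≤ α₄ / 4)
    -- the competitors
    {v w : Site d → 𝔸ˣ} {lam mu : Site d → 𝔸}
    (hv : ∀ x, ((gaugeExp lam x : 𝔸ˣ) : 𝔸) = ((v x : 𝔸ˣ) : 𝔸) ∧ IsSelfAdjoint (lam x) ∧ ‖lam x‖ < cu)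
    (hvD : ∀ j, j ≤ k → ∀ b ∈ {b : Site d × Fin d | SideTouches (Ω j) b.1 b.2}, ((L : ℝ) ^ j * η) * ‖covDerivFwd η U₀ b.2 lam b.1‖ < cu)
    (hw : ∀ x, ((gaugeExp mu x : 𝔸ˣ) : 𝔸) = ((w x : 𝔸ˣ) : 𝔸) ∧ IsSelfAdjoint (mu x) ∧ ‖mu x‖ < cu)
    (hwD : ∀ j, j ≤ k → ∀ b ∈ {b : Site d × Fin d | SideTouches (Ω j) b.1 b.2}, ((L : ℝ) ^ j * η) * ‖covDerivFwd η U₀ b.2 mu b.1‖ < cu)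
    (hLv : IsLandau138W L k η (Ω 0) (Λs k) U₀ (mgauge U₀ v⁻¹ (mgauge U₀ u₁⁻¹ U'))) (hRv : Restr129 L k (Λs k) U₀ (u₁ * v))
    (hLw : IsLandau138W L k η (Ω 0) (Λs k) U₀ (mgauge U₀ w⁻¹ (mgauge U₀ u₁⁻¹ U'))) (hRw : Restr129 L k (Λs k) U₀ (u₁ * w)) :
    ∀ x, v x = w x := by
  subst hcs
  have hL1 : 1 ≤ L := le_trans (by norm_num) hL
  have hd1 : 1 ≤ d := le_trans (by norm_num) hd2
  have hLr : (1 : ℝ) ≤ L := by exact_mod_cast hL1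
  have hd0 : (1 : ℝ) ≤ d := by exact_mod_cast hd1
  have huniv : ∀ x, x ∈ Ω 0 := fun x => by rw [hΩ0]; exact Set.mem_univ x
  obtain ⟨k', rfl⟩ : ∃ k', k = k' + 1 := ⟨k - 1, (Nat.sub_add_cancel hk).symm⟩
  have hsum : 0 < α₀ + α₁ := add_pos hα₀ hα₁
  have hcs0 : 0 ≤ 5 * (d : ℝ) * L * B₀ * (α₀ + α₁) := by positivity
  have hcspos : 0 < 5 * (d : ℝ) * L * B₀ * (α₀ + α₁) := by positivity
  have hα₄pos : 0 < α₄ := hα₄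
  -- `c⋆ ≤ L·c⋆ ≤ cB`, hence Prop. 3's remaining windows from the JOIN's
  have hcsB : 5 * (d : ℝ) * L * B₀ * (α₀ + α₁) ≤ cB := (le_mul_of_one_le_left hcs0 hLr).trans hcBlo
  have hcB0 : 0 ≤ cB := hcs0.trans hcsB
  have hcA0 : 0 ≤ cA := (hcs0.trans (le_mul_of_one_le_left hcs0 hLr)).trans hcAlo
  have hcDA0 : 0 ≤ cDA := le_trans (by positivity) hcDAlo
  have hcBsmall : (d : ℝ) * cB ≤ 1 / 8000 := by linarith only [hα₃']
  have hdcs : (d : ℝ) * (5 * (d : ℝ) * L * B₀ * (α₀ + α₁)) ≤ 1 / 8000 :=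
    (mul_le_mul_of_nonneg_left hcsB (by positivity)).trans hcBsmall
  have hcs8000 : 5 * (d : ℝ) * L * B₀ * (α₀ + α₁) ≤ 1 / 8000 := (le_mul_of_one_le_left hcs0 hd0).trans hdcs
  have h16 : 16 * (5 * (d : ℝ) * L * B₀ * (α₀ + α₁)) ≤ 1 := by linarith only [hcs8000]
  have h50 : 50 * d * (5 * (d : ℝ) * L * B₀ * (α₀ + α₁)) ≤ 1 := by linarith only [hdcs]
  have hd5 : 5 * (5 * (d : ℝ) * L * B₀ * (α₀ + α₁)) * ((d : ℝ) - 1) ≤ 4 := by nlinarith only [hdcs, hcs0]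
  have hc₃3 : 2 * (5 * (d : ℝ) * L * B₀ * (α₀ + α₁)) ≤ c3 d L := by linarith only [hc₃, hcsB]
  have hsmall3 : Real.exp (4 * (800 * ((d : ℝ) + 1) ^ 2 * ((d : ℝ) + 4)) * α₀) *
      (1 + 8 * (131072 * ((d : ℝ) + 1) ^ 2) * (5 * (d : ℝ) * L * B₀ * (α₀ + α₁))) ≤ 2 := by
    refine le_trans (mul_le_mul_of_nonneg_left ?_ (Real.exp_pos _).le) hsmall
    have h := mul_le_mul_of_nonneg_left hcsB (show (0 : ℝ) ≤ 8 * (131072 * ((d : ℝ) + 1) ^ 2) by positivity)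
    linarith only [h]
  have hαP2 : 2 * α₀ ≤ c2' d L := by linarith only [hα4, hα₀]
  have hC2 : 0 ≤ C2p d := B8Ineq125Concrete.C2p_nonneg d
  have hhE : 0 ≤ hE := by rw [hE_def]; positivity
  -- the datum `U₁ = U′^{u₁⁻¹}`: unitary, `U₁^{u₁} = U′`, and its Hermitian logarithm on the touched bonds ((1.62)-shape ⇒ `logField_spec`)
  set U₁ : Site d → Fin d → 𝔸ˣ := mgauge U₀ u₁⁻¹ U' with hU₁def
  have hW : mgauge U₀ u₁ U₁ = U' := mgauge_mgauge_inv U₀ U' u₁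
  have hWu : ∀ x κ, U₁ x κ ∈ unitaryUnits 𝔸 := mem_unitaryUnits_of_mgauge_eq hU₀ hU' hu₁ hW
  obtain ⟨A₁, hA₁⟩ := hdat
  have hdat' : ∀ j, j ≤ k' + 1 → ∀ b ∈ {b : Site d × Fin d | SideTouches (Ω j) b.1 b.2},
      U₁ b.1 b.2 = cfgExp η (logCfg η U₁) b.1 b.2 ∧ IsSelfAdjoint (logCfg η U₁ b.1 b.2) ∧
        ‖logCfg η U₁ b.1 b.2‖ ≤ (5 * (d : ℝ) * L * B₀ * (α₀ + α₁)) * ((L : ℝ) ^ j * η)⁻¹ := by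
    intro j hj b hb
    obtain ⟨hexp, hbd⟩ := hA₁ j hj b.1 b.2 hb
    have hbd' : ‖A₁ b.1 b.2‖ ≤ (5 * (d : ℝ) * L * B₀ * (α₀ + α₁)) * η⁻¹ := by
      refine hbd.trans ?_
      have hLj : (1 : ℝ) ≤ (L : ℝ) ^ j := one_le_pow₀ hLr
      have : ((L : ℝ) ^ j * η)⁻¹ ≤ η⁻¹ := by
        rw [mul_inv]
        calc ((L : ℝ) ^ j)⁻¹ * η⁻¹ ≤ 1 * η⁻¹ := by gcongr; exact inv_le_one_of_one_le₀ hLj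
          _ = η⁻¹ := one_mul _
      exact mul_le_mul_of_nonneg_left this hcs0
    obtain ⟨hlogA, hsa, hWexp⟩ := logField_spec hη U₀ hWu hexp hbd' (by linarith only [h16])
    refine ⟨hWexp, ?_, ?_⟩
    · simpa [logCfg] using hsa
    · show ‖logCfg η U₁ b.1 b.2‖ ≤ _
      rw [logCfg, hlogA]
      exact hbd
  -- the MASKED exponent `A′` (globally Hermitian); at `Ω 0 = univ` every bond is touched, so `U₁ = e^{iηA′}` GLOBALLY
  obtain ⟨A', hsa, -, hWA, hA0⟩ := exists_masked_datum hdat'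
  have hWA1 : ∀ j, j ≤ k' → ∀ (y : Site d) (τ : Fin d), SideTouches (Ω j) y τ → U₁ y τ = cfgExp η A' y τ :=
    fun j hj y τ hs => (hWA j (Nat.le_succ_of_le hj) y τ hs).1
  have h41 : ∀ j, j ≤ k' → ∀ (y : Site d) (τ : Fin d), SideTouches (Ω j) y τ →
      ‖A' y τ‖ ≤ (5 * (d : ℝ) * L * B₀ * (α₀ + α₁)) * ((L : ℝ) ^ j * η)⁻¹ := fun j hj y τ hs => (hWA j (Nat.le_succ_of_le hj) y τ hs).2
  have htouch0 : ∀ (y : Site d) (τ : Fin d), SideTouches (Ω 0) y τ := fun y τ => (sideTouches_pair_of_mem hd2 (huniv y) τ).1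
  have hU₁eq : U₁ = cfgExp η A' := funext fun y => funext fun τ => (hWA 0 (Nat.zero_le _) y τ (htouch0 y τ)).1
  have hA'0 : ∀ (y : Site d) (τ : Fin d), ‖A' y τ‖ ≤ (5 * (d : ℝ) * L * B₀ * (α₀ + α₁)) * η⁻¹ := fun y τ => by
    have h := (hWA 0 (Nat.zero_le _) y τ (htouch0 y τ)).2
    rwa [pow_zero, one_mul] at h
  -- the JOIN's datum binders BY NAME (`B8Prop5SocketDatum` §7, §3–§4)
  have h33' := h33_of_inAk hL1 hα₀ h33 le_rfl htower
  have hP' := hP_of_datum hL1 hα₀ hΩ h34 le_rfl htower hu₁ hW hWA1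
  have h69' : ∀ j, j ≤ k' + 1 → ∀ y ∈ Λs (k' + 1) j, ∀ (x : Site d) (κ : Fin d), InBox (tlo L y j) (thi L y j) x →
      InBox (tlo L y j) (thi L y j) (x + e κ) → ‖iEta η A' x κ‖ ≤ cB * ((L : ℝ) ^ j)⁻¹ :=
    fun j hj y hy x κ hx hxe =>
      (h69_of_datum hd2 hL1 hη hΩ htower hcs0 h41 j hj y hy x κ hx hxe).trans (mul_le_mul_of_nonneg_right hcBlo (by positivity))
  have hAd : ∀ j, j ≤ k' + 1 → ∀ x ∈ Ω j, ∀ μ : Fin d,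
      wt L η j * ‖A' x μ‖ ≤ cA ∧ wt L η j * ‖conjR (U₀ (x - e μ) μ)⁻¹ (A' (x - e μ) μ)‖ ≤ cA := fun j hj x hx μ =>
    ⟨(hA_of_datum hd2 hL1 hη hΩ hU₀ hcs0 h41 j hj x hx μ).1.trans hcAlo, (hA_of_datum hd2 hL1 hη hΩ hU₀ hcs0 h41 j hj x hx μ).2.trans hcAlo⟩
  have hBu : ∀ (x : Site d) (κ : Fin d), expCfg (iEta η A') x κ ∈ unitaryUnits 𝔸 := expCfg_iEta_mem_unitaryUnits η hsa
  have hexpA : expCfg (iEta η A') = U₁ := by rw [expCfg_iEta_eq_cfgExp, hU₁eq]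
  have hAx' : InAx L (k' + 1) (Λs (k' + 1)) U₀ (mgauge U₀ u₁ (expCfg (iEta η A')) * U₀) := by
    rw [hexpA, hW, ← mulCfg_eq_mul]
    exact hAx (k' + 1) le_rfl
  -- the source `D*A′`: (1.69)'s gradient member by Prop. 3 at the top level (§3), then `|D*A′|₍₋₂₎ ≤ d·L²·c⋆ ≤ cDA` (§4)
  have hgrad := grad_bound_of_datum hd2 hη hL (k' + 1) hU₀ hU' hα₀ hα₁ hcspos hB₀.le hα3 hα4 h16 hd5 hsmall3 hc₃3 hside h50 hC₂ h61
    hsmall₁ Ω hΩ Λs Λb hbox hclass h33 h34 hAx h135 hk le_rfl SB9 hα₀9 hcs9 hu₁ hW h129 hLan hsa hWA hA0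
  have hDA : Bd2 L η (k' + 1) Ω (fun y => covDivB η U₀ A' y) cDA := fun j hj x hx =>
    (bd2_covDivB_of_grad hd2 hL1 hη hΩ hU₀ hcs0 (fun j hj y κ τ hs => hgrad j (Nat.le_succ_of_le hj) y κ τ hs) j hj x hx).trans hcDAlo
  -- the JOIN's bond classes `Eb j := {b ∣ SideTouches (Ω j) b}` (§6)
  have hEbΩ : ∀ j, j ≤ k' + 1 → ∀ x ∈ Ω j, ∀ μ : Fin d, (x, μ) ∈ {b : Site d × Fin d | SideTouches (Ω j) b.1 b.2} ∧
      (x - e μ, μ) ∈ {b : Site d × Fin d | SideTouches (Ω j) b.1 b.2} := fun j _ x hx μ => sideTouches_pair_of_mem hd2 hx μ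
  have hEbT : ∀ j, j ≤ k' + 1 → ∀ y ∈ Λs (k' + 1) j, ∀ (x : Site d) (κ : Fin d), InBox (tlo L y j) (thi L y j) x →
      InBox (tlo L y j) (thi L y j) (x + e κ) → (x, κ) ∈ {b : Site d × Fin d | SideTouches (Ω j) b.1 b.2} :=
    fun j hj y hy x κ hx _ => sideTouches_of_tower_bond hd2 htower hj hy x κ hx
  -- each competitor: `v = e^{iλ}` globally; its (1.38) of record is the multiplier clause of `HFP` at `A′` by the D*-identity
  have hcu4 : cu ≤ α₄ / 4 := by linarith only [hcu, hhE]
  have hcu12 : cu ≤ 1 / 12 := by linarith only [hcu4, ha₁', hhE]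
  have hcu70 : cu ≤ 1 / 70 := by linarith only [hcu4, hb₁', hhE]
  have hcomp : ∀ (vv : Site d → 𝔸ˣ) (ll : Site d → 𝔸),
      (∀ x, ((gaugeExp ll x : 𝔸ˣ) : 𝔸) = ((vv x : 𝔸ˣ) : 𝔸) ∧ IsSelfAdjoint (ll x) ∧ ‖ll x‖ < cu) →
      (∀ j, j ≤ k' + 1 → ∀ b ∈ {b : Site d × Fin d | SideTouches (Ω j) b.1 b.2}, ((L : ℝ) ^ j * η) * ‖covDerivFwd η U₀ b.2 ll b.1‖ < cu) →
      IsLandau138W L (k' + 1) η (Ω 0) (Λs (k' + 1)) U₀ (mgauge U₀ vv⁻¹ (mgauge U₀ u₁⁻¹ U')) →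
      vv = gaugeExp ll ∧ (∀ x, ‖ll x‖ ≤ cu) ∧
      (∀ j, j ≤ k' + 1 → ∀ p ∈ {b : Site d × Fin d | SideTouches (Ω j) b.1 b.2}, wt L η j * ‖covDerivFwd η U₀ p.2 ll p.1‖ ≤ cu) ∧
      (∃ μ : ℕ → Site d → 𝔸, ∀ x ∈ Ω 0,
        covLap η U₀ ((Ω 0).indicator fun y => covDivB η U₀ A' y + covLap η U₀ ll y +
          ((conjR (gaugeExp ll y)⁻¹ (covDivB η U₀ A' y) - covDivB η U₀ A' y) +
            (gAd (covLap η U₀ ll y) (ll y) - covLap η U₀ ll y) + ∑ μ, frakF3 η U₀ ll A' y μ)) x = QT L (k' + 1) (Λs (k' + 1)) U₀ μ x) := by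
    intro vv ll hll hllD hL138
    have hveq : vv = gaugeExp ll := funext fun x => (Units.ext (hll x).1).symm
    refine ⟨hveq, fun x => (hll x).2.2.le, fun j hj p hp => (hllD j hj p hp).le, ?_⟩
    -- the Landau condition of record for `U₁^{v⁻¹} = (e^{iηA′})^{(e^{iλ})⁻¹}`, rewritten by the D*-identity on `Ω₀`
    have hL' : IsLandau138W L (k' + 1) η (Ω 0) (Λs (k' + 1)) U₀ (mgauge U₀ (gaugeExp ll)⁻¹ (cfgExp η A')) := by
      rw [← hveq, ← hU₁eq]; exact hL138
    obtain ⟨μ, hμ⟩ := hL'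
    refine ⟨μ, fun x hx => ?_⟩
    have hind : ((Ω 0).indicator fun y => covDivB η U₀ A' y + covLap η U₀ ll y +
        ((conjR (gaugeExp ll y)⁻¹ (covDivB η U₀ A' y) - covDivB η U₀ A' y) +
          (gAd (covLap η U₀ ll y) (ll y) - covLap η U₀ ll y) + ∑ μ, frakF3 η U₀ ll A' y μ)) =
        (Ω 0).indicator (covDivB η U₀ (logCfg η (mgauge U₀ (gaugeExp ll)⁻¹ (cfgExp η A')))) := by
      refine Set.indicator_congr fun y _ => ?_
      have hly : ‖ll y‖ ≤ 1 / 12 := (hll y).2.2.le.trans hcu12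
      have hDy : ∀ ν : Fin d, η * ‖covDerivFwd η U₀ ν ll y‖ ≤ 1 / 70 := fun ν => by
        have h := (hllD 0 (Nat.zero_le _) (y, ν) (htouch0 y ν)).le
        rw [pow_zero, one_mul] at h
        exact h.trans hcu70
      have hay : ∀ ν : Fin d, η * ‖covDeriv η U₀ ν ll y‖ ≤ 1 / 70 := fun ν => by
        rw [norm_covDeriv_eq hU₀]
        have h := (hllD 0 (Nat.zero_le _) (y - e ν, ν) (htouch0 (y - e ν) ν)).le
        rw [pow_zero, one_mul] at h
        exact h.trans hcu70
      have hYy : ∀ ν : Fin d, η * ‖conjR (U₀ (y - e ν) ν)⁻¹ (A' (y - e ν) ν)‖ ≤ 1 / 12 := fun ν => by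
        have hu : ((U₀ (y - e ν) ν)⁻¹ : 𝔸ˣ) ∈ U1 𝔸 := (U1 𝔸).inv_mem (unitaryUnits_le_U1 (hU₀ _ ν))
        rw [norm_conjR hu]
        calc η * ‖A' (y - e ν) ν‖ ≤ η * ((5 * (d : ℝ) * L * B₀ * (α₀ + α₁)) * η⁻¹) := mul_le_mul_of_nonneg_left (hA'0 _ ν) hη.le
          _ = 5 * (d : ℝ) * L * B₀ * (α₀ + α₁) := by field_simp
          _ ≤ 1 / 12 := by linarith only [h16]
      exact (covDivB_logCfg_gaugeFixed hη U₀ A' hly hDy hay hYy).symm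
    rw [hind]
    exact hμ x hx
  obtain ⟨hveq, hl₁, hD₁, hmult₁⟩ := hcomp v lam hv hvD hLv
  obtain ⟨hweq, hl₂, hD₂, hmult₂⟩ := hcomp w mu hw hwD hLw
  have hR₁ : Restr129 L (k' + 1) (Λs (k' + 1)) U₀ (u₁ * gaugeExp lam) := by rw [← hveq]; exact hRv
  have hR₂ : Restr129 L (k' + 1) (Λs (k' + 1)) U₀ (u₁ * gaugeExp mu) := by rw [← hweq]; exact hRw
  -- unitary Λ_j-witnesses for `u₁` (Theorem 4's inductive gauge transformation) at class constant `40d·c_B`, from (1.34), (1.29)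
  have hα₃0 : (0 : ℝ) ≤ 40 * d * cB := by positivity
  have hwit : ∀ j, j ≤ k' + 1 → ∀ y ∈ Λs (k' + 1) j, ∃ ut : Site d → 𝔸ˣ, (∀ x, ut x ∈ unitaryUnits 𝔸) ∧
      InLambda L (clampCfg (tlo L y j) (thi L y j) U₀) ut j (40 * d * cB) (((L : ℝ) ^ j)⁻¹) ∧
      ∀ x : Site d, tlo L y j ≤ x → x ≤ thi L y j → u₁ x = ut x := fun j hj y hy =>
    witness_unitary_of_glev hd1 hL hU₀ hα₀ hα3 hα4 (h33' j hj y hy) hcB0 hsmall hc₃ hsc hα₀ hα3 hαP2 hL1 hBu (h69' j hj y hy) (hP' j hj y hy)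
      (glev_on_towers_of_axial hL1 (Λs (k' + 1)) hAx' h129 j hj y hy)
  -- THE UNIQUENESS JOIN AT PRINT'S GENERALITY, GUARDED LEFT INVERSE (`hFP_unique_of_sectE_local_wb`, BY NAME) at `ρ := c_u`, `α₃ := 40d·c_B`
  have heq : lam = mu := hFP_unique_of_sectE_local_wb (Ω := Ω) (Λs := Λs (k' + 1))
    (Eb := fun j => {b : Site d × Fin d | SideTouches (Ω j) b.1 b.2}) (u₁ := u₁) (A := A') hL hη hU₀ hΩ0 hEbΩ hEbT g Δ q qs Aw c g_leftB
    c_left' hΔ hqs hq hq0 H' hα₀ hα3 hα4 hα₃0 hα₄pos hB₀'H hB₂' h33' hwit h129 hH0 hH1 hH2 hQH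
    hα₃' hs₁ hs₂ hs₃ hs₄ hs₅ hs₆ hs₇ hsm hprod8 hE_def hE₂_def lE_def lE₂_def hBG hBR hcA0 hcA' hcDA0 ha₁' hb₁' hθ hlE hcu hG hRbd hDA hAd
    h103 h106 hl₁ hD₁ hmult₁ hR₁ hl₂ hD₂ hmult₂ hR₂
  intro x
  rw [hveq, hweq, heq]



/-! ## §2 The socket at one member, and one threshold for the whole `Ω 0 = univ` sub-family — from the GUARDED uniqueness-letters family -/

open B8LeafModelZdSockP5uE (SockP5uE)
open B8SockP5uEWindows (uniqWindows_of_guard)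

section OneMember

variable {L : ℕ} {η : ℝ} {k : ℕ} {Ω : ℕ → Set (Site d)} {Λs : ℕ → ℕ → Set (Site d)} {Λb : ℕ → ℕ → Set (Site d × Fin d)}
  {B₀ B₀'H B₂' BG BR cB9 cL cP cu α₄ B₀β β : ℝ} {len : Site d → ℝ}

/-- **`SockP5uE` AT ONE MEMBER FROM THE GUARDED UNIQUENESS-LETTERS FAMILY** — n04-b's `B8SockP5uEAssembly.sockP5uE_of_lettersU` VERBATIM except
that conjunct 1 of the letters family is the left-inverse law of `G′` ON BOUNDED FUNCTIONS (`∀ x, (∃ C, ∀ y, ‖x y‖ ≤ C) → G′(Δx + Q′ᵀ𝔄Q′x) = x`,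
[4] Thm 3.1 p. 397 as printed; W8″) and the body is `sockP5uE_body_of_join_b`.  The socket `SockP5uE` (owner `pub-ymgap-dag-n05-a`) is UNCHANGED.
[cite: Balaban1985RegularSpaces, Prop. 5 (1.109) p.94, Thm 4 p.88, p.95; Balaban1985BackgroundPropagators, Thm 3.1 p.397] -/
theorem sockP5uE_of_lettersUB (hd2 : 2 ≤ d) (hL : 2 ≤ L) (hη : 0 < η) (hk : 1 ≤ k) (hΩ : ∀ j, Ω (j + 1) ⊆ Ω j) (hΩ0 : Ω 0 = Set.univ)
    (hbox : ∀ m, m ≤ k → ∀ j, j ≤ m → ∀ c ∈ Λb m j, ∀ x, InBox (loK L j c.1) (bondHiK L j c.1 c.2) x → x ∈ Ω j)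
    (hclass : ∀ m, m ≤ k → ∀ j, j ≤ m → ∀ c ∈ Λb m j,
      (c.1 ∈ Λs m j ∧ c.1 + e c.2 ∈ Λs m j) ∨
      (∃ j', j = j' + 1 ∧ (∀ x, (L : ℤ) • c.1 ≤ x → x ≤ (L : ℤ) • c.1 + blockTop L → x ∈ Λs m j') ∧ c.1 + e c.2 ∈ Λs m j) ∨
      (∃ j', j = j' + 1 ∧ c.1 ∈ Λs m j ∧ (∀ x, (L : ℤ) • (c.1 + e c.2) ≤ x → x ≤ (L : ℤ) • (c.1 + e c.2) + blockTop L → x ∈ Λs m j')))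
    (htower : ∀ j, j ≤ k → ∀ y ∈ Λs k j, ∀ x, InBox (tlo L y j) (thi L y j) x → x ∈ Ω j)
    (hB₀ : 0 < B₀) (hB₀'H : 0 < B₀'H) (hB₂' : 0 ≤ B₂') (hBG : 0 ≤ BG) (hBR : 0 ≤ BR) (hα₄ : 0 < α₄)
    -- (i) the uniqueness-letters family at the top structure `(k, Λs k)`
    (SLetUB : ∀ α₀ : ℝ, 0 < α₀ → α₀ ≤ cL → ∀ U₀ : Site d → Fin d → 𝔸ˣ, (∀ x κ, U₀ x κ ∈ unitaryUnits 𝔸) → InAk L k η α₀ Ω U₀ →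
      ∃ (g Δ : (Site d → 𝔸) →ₗ[ℂ] (Site d → 𝔸)) (q : (Site d → 𝔸) →ₗ[ℂ] (ℕ → Site d → 𝔸)) (qs : (ℕ → Site d → 𝔸) →ₗ[ℂ] (Site d → 𝔸))
        (Aw c : (ℕ → Site d → 𝔸) →ₗ[ℂ] (ℕ → Site d → 𝔸)) (H' : XSpace d k 𝔸 →ₗ[ℂ] (Site d → 𝔸)),
        (∀ x : Site d → 𝔸, (∃ C : ℝ, ∀ y, ‖x y‖ ≤ C) → g (Δ x + qs (Aw (q x))) = x) ∧ (∀ φ, qs (c (q (g (g (qs φ))))) = qs φ) ∧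
        (∀ (f : Site d → 𝔸), ∀ x ∈ Ω 0, Δ f x = covLap η U₀ ((Ω 0).indicator f) x) ∧
        (∀ (μ : ℕ → Site d → 𝔸), ∀ x ∈ Ω 0, qs μ x = QT L k (Λs k) U₀ μ x) ∧
        (∀ (f : Site d → 𝔸) (j : ℕ), j ≤ k → ∀ y ∈ Λs k j, q f j y = QprimeIter (zdBlocking d L) (bgT L U₀) j f y) ∧
        (∀ (f : Site d → 𝔸) (j : ℕ) (y : Site d), ¬ (j ≤ k ∧ y ∈ Λs k j) → q f j y = 0) ∧
        (∀ (X : XSpace d k 𝔸) (x : Site d), ‖H' X x‖ ≤ B₀'H * ‖X‖) ∧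
        (∀ j, j ≤ k → ∀ (X : XSpace d k 𝔸), ∀ p ∈ {b : Site d × Fin d | SideTouches (Ω j) b.1 b.2},
          wt L η j * ‖covDerivFwd η U₀ p.2 (H' X) p.1‖ ≤ B₀'H * ‖X‖) ∧
        (∀ X : XSpace d k 𝔸, Bd2 L η k Ω (covLap η U₀ (H' X)) (B₂' * ‖X‖)) ∧
        (∀ (Y : XSpace d k 𝔸) (j : ℕ) (hj : j ≤ k) (y : Site d), y ∈ Λs k j →
          QprimeIter (zdBlocking d L) (bgT L U₀) j (H' Y) y = Y (⟨j, Nat.lt_succ_of_le hj⟩, y)) ∧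
        (∀ (f : Site d → 𝔸) (r : ℝ), 0 ≤ r → Bd2 L η k Ω f r →
          (∀ x, ‖g f x‖ ≤ BG * r) ∧ ∀ j, j ≤ k → ∀ p ∈ {b : Site d × Fin d | SideTouches (Ω j) b.1 b.2},
            wt L η j * ‖covDerivFwd η U₀ p.2 (g f) p.1‖ ≤ BG * r) ∧
        (∀ (f : Site d → 𝔸) (r : ℝ), 0 ≤ r → Bd2 L η k Ω f r → Bd2 L η k Ω (f - g (qs (c (q (g f))))) (BR * r)))
    -- (ii) the b9 socket at every truncation (the top one is read)
    (SB9all : ∀ m, m ≤ k → SockB9P3 (𝔸 := 𝔸) L B₀ B₀β cB9 β len η m Ω Λs Λb) (hcPL : cP ≤ cL)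
    -- (iii) the windows family below `c_P` at the fixed radius `α₄` and socket radius `c_u`
    (hwin : ∀ α₀ α₁ : ℝ, 0 < α₀ → 0 < α₁ → α₀ + α₁ ≤ cP →
      ∀ cs cB cDA hE hE₂ lE lE₂ : ℝ, cs = 5 * (d : ℝ) * L * B₀ * (α₀ + α₁) → cB = L * cs → cDA = (d : ℝ) * (L : ℝ) ^ 2 * cs →
      hE = B₀'H * (C2p d * (40 * d * cB + α₄) * α₄) → hE₂ = B₂' * (C2p d * (40 * d * cB + α₄) * α₄) →
      lE = B₀'H * (4 * C2p d * (40 * d * cB + 2 * α₄)) → lE₂ = B₂' * (4 * C2p d * (40 * d * cB + 2 * α₄)) →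
      36 * d * B₀ * cs ≤ 1 / 2 ∧
      8 * (131072 * ((d : ℝ) + 1) ^ 2) * Real.exp (4 * (800 * ((d : ℝ) + 1) ^ 2 * ((d : ℝ) + 4)) * α₀) ≤ 16 * (131072 * ((d : ℝ) + 1) ^ 2) ∧
      2 * cs ^ 2 + 20 * d * α₀ * cs + 2 * (16 * (131072 * ((d : ℝ) + 1) ^ 2)) * cs ^ 2 ≤ α₀ + α₁ ∧
      (d : ℝ) * L * α₁ ≤ 1 / 8 ∧
      α₀ ≤ cB9 ∧ cs ≤ cB9 ∧
      C0 d * α₀ ≤ 1 / 3 ∧ 4 * α₀ ≤ c2' d L ∧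
      Real.exp (4 * (800 * ((d : ℝ) + 1) ^ 2 * ((d : ℝ) + 4)) * α₀) * (1 + 8 * (131072 * ((d : ℝ) + 1) ^ 2) * cB) ≤ 2 ∧
      2 * cB ≤ c3 d L ∧ 2048 * (d : ℝ) * cB ≤ 1 ∧ 40 * d * cB ≤ 1 / 200 ∧
      200 * C6 d * (2 * α₄) ≤ 1 ∧ 12000 * ((d : ℝ) + 1) * L * (2 * α₄) ≤ 1 ∧
      C4G d L * (α₀ + 40 * d * cB + 4 * (2 * α₄)) ≤ 1 ∧
      1024 * ((d : ℝ) + 1) * ((d : ℝ) + 4) * L ^ 2 * α₀ ≤ 1 ∧ 32 * ((d : ℝ) + 1) ^ 2 * C6 d * L ^ 2 * α₀ ≤ 1 ∧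
      16 * d * C5' d * C6 d * (L : ℝ) ^ 2 * α₀ ≤ 1 ∧ 8 * d * C6 d * L * α₀ ≤ 1 ∧
      40 * d * cB + α₄ ≤ 1 / (4 * B₀'H * (2 * C2p d)) ∧ 2 * C6 d * (40 * d * cB + 4 * α₄) ≤ 1 / 8 ∧
      cB ≤ 1 / 13 ∧ α₄ / 4 + hE ≤ 1 / 24 ∧ α₄ / 4 + hE ≤ 1 / 140 ∧ 10 * (α₄ / 4 + hE) * BR ≤ 1 / 2 ∧
      BG * Mc d BR (α₄ / 4 + hE) cB hE₂ cDA ≤ α₄ / 4 ∧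
      BG * Kc d BR (α₄ / 4 + hE) cB hE₂ cDA lE₂ (1 + lE) (1 + lE) ≤ 1 / 2 ∧
      lE ≤ 1 / 2 ∧ cu + hE ≤ α₄ / 4) :
    SockP5uE (𝔸 := 𝔸) L B₀ cP cu η k Ω Λs := by
  intro α₀ α₁ hα₀ hα₁ hs U₀ U' hU₀ hU' h33 h34 hAx h135 _ u₁ hu₁ _ h129 hLan hdat v w lam mu hv _ hvD hw _ hwD hLv hRv hLw hRw
  -- the windows at this (α₀, α₁)
  obtain ⟨hside, hC₂, h61, hsmall₁, hα₀9, hcs9, hα3, hα4, hsmall, hc₃, hsc, hα₃', hs₁, hs₂, hs₃, hs₄, hs₅, hs₆, hs₇, hsm, hprod8, hcA', ha₁',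
    hb₁', hθ, h103, h106, hlE, hcu⟩ := hwin α₀ α₁ hα₀ hα₁ hs _ _ _ _ _ _ _ rfl rfl rfl rfl rfl rfl rfl
  -- the letters at the top structure
  have hα₀L : α₀ ≤ cL := by linarith
  obtain ⟨g, Δ, q, qs, Aw, c, H', g_leftB, c_left', hΔ, hqs, hq, hq0, hH0, hH1, hH2, hQH, hG, hRbd⟩ := SLetUB α₀ hα₀ hα₀L U₀ hU₀ h33
  exact sockP5uE_body_of_join_b hd2 hL hη hk hΩ hΩ0 hbox hclass htower hα₀ hα₁ hB₀ rfl hα₄ hU₀ hU' h33 h34 hAx h135 hu₁ h129 hLan hdat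
    (SB9all k le_rfl) hα₀9 hcs9 hside hC₂ h61 hsmall₁ g Δ q qs Aw c g_leftB c_left' hΔ hqs hq hq0 H' hB₀'H hB₂' hBG hBR hH0 hH1 hH2 hQH hG
    hRbd le_rfl le_rfl le_rfl hα3 hα4 hsmall hc₃ hsc hα₃' hs₁ hs₂ hs₃ hs₄ hs₅ hs₆ hs₇ hsm hprod8 rfl rfl rfl rfl hcA' ha₁' hb₁' hθ h103 h106
    hlE hcu hv hvD hw hwD hLv hRv hLw hRw

end OneMember

/-! ### One socket radius and one threshold for the whole `Ω 0 = univ` sub-family -/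

/-- **THE REPAIRED UNIQUENESS SOCKET OF THE N05 KNIT BELOW ONE THRESHOLD, AT ONE RADIUS, FROM THE GUARDED UNIQUENESS-LETTERS FAMILY** —
n04-b's `B8SockP5uEAssembly.exists_threshold_sockP5uE` VERBATIM except conjunct 1 of the letters family (left-inverse law of `G′` on bounded
functions only): print's «there exist positive constants c₂, c₃»: ONE socket radius `c_u` and ONE threshold `c_F = min(c_P, c_L)` such that at
EVERY `Ω 0 = univ` member the guarded uniqueness-letters family and the b9 socket give `SockP5uE L B₀ c_F c_u η k Ω Λs`.
[cite: Balaban1985RegularSpaces, Prop. 5 (1.109) p.94 («c₂, c₃»; «largest possible α₄ … independent of α₀ + α₁»), Thm 4 p.88, p.95; Balaban1985BackgroundPropagators, Thm 3.1 p.397] -/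
theorem exists_threshold_sockP5uEB (hd2 : 2 ≤ d) {L : ℕ} (hL : 2 ≤ L) {B₀ B₀'H B₂' BG BR cB9 cL : ℝ} (hB₀ : 0 < B₀)
    (hB : 2 ≤ 5 * (d : ℝ) * L * B₀) (hB₀'H : 0 < B₀'H) (hB₂' : 0 ≤ B₂') (hBG : 0 ≤ BG) (hBR : 0 ≤ BR) (hcB9 : 0 < cB9) (hcL : 0 < cL) :
    ∃ cu cF : ℝ, 0 < cu ∧ 0 < cF ∧ ∀ {η : ℝ}, 0 < η → ∀ {k : ℕ}, 1 ≤ k → ∀ {Ω : ℕ → Set (Site d)}, (∀ j, Ω (j + 1) ⊆ Ω j) → Ω 0 = Set.univ →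
      ∀ {Λs : ℕ → ℕ → Set (Site d)} {Λb : ℕ → ℕ → Set (Site d × Fin d)},
      (∀ m, m ≤ k → ∀ j, j ≤ m → ∀ c ∈ Λb m j, ∀ x, InBox (loK L j c.1) (bondHiK L j c.1 c.2) x → x ∈ Ω j) →
      (∀ m, m ≤ k → ∀ j, j ≤ m → ∀ c ∈ Λb m j,
        (c.1 ∈ Λs m j ∧ c.1 + e c.2 ∈ Λs m j) ∨
        (∃ j', j = j' + 1 ∧ (∀ x, (L : ℤ) • c.1 ≤ x → x ≤ (L : ℤ) • c.1 + blockTop L → x ∈ Λs m j') ∧ c.1 + e c.2 ∈ Λs m j) ∨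
        (∃ j', j = j' + 1 ∧ c.1 ∈ Λs m j ∧ (∀ x, (L : ℤ) • (c.1 + e c.2) ≤ x → x ≤ (L : ℤ) • (c.1 + e c.2) + blockTop L → x ∈ Λs m j'))) →
      (∀ j, j ≤ k → ∀ y ∈ Λs k j, ∀ x, InBox (tlo L y j) (thi L y j) x → x ∈ Ω j) →
      (∀ α₀ : ℝ, 0 < α₀ → α₀ ≤ cL → ∀ U₀ : Site d → Fin d → 𝔸ˣ, (∀ x κ, U₀ x κ ∈ unitaryUnits 𝔸) → InAk L k η α₀ Ω U₀ →
        ∃ (g Δ : (Site d → 𝔸) →ₗ[ℂ] (Site d → 𝔸)) (q : (Site d → 𝔸) →ₗ[ℂ] (ℕ → Site d → 𝔸)) (qs : (ℕ → Site d → 𝔸) →ₗ[ℂ] (Site d → 𝔸))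
          (Aw c : (ℕ → Site d → 𝔸) →ₗ[ℂ] (ℕ → Site d → 𝔸)) (H' : XSpace d k 𝔸 →ₗ[ℂ] (Site d → 𝔸)),
          (∀ x : Site d → 𝔸, (∃ C : ℝ, ∀ y, ‖x y‖ ≤ C) → g (Δ x + qs (Aw (q x))) = x) ∧ (∀ φ, qs (c (q (g (g (qs φ))))) = qs φ) ∧
          (∀ (f : Site d → 𝔸), ∀ x ∈ Ω 0, Δ f x = covLap η U₀ ((Ω 0).indicator f) x) ∧
          (∀ (μ : ℕ → Site d → 𝔸), ∀ x ∈ Ω 0, qs μ x = QT L k (Λs k) U₀ μ x) ∧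
          (∀ (f : Site d → 𝔸) (j : ℕ), j ≤ k → ∀ y ∈ Λs k j, q f j y = QprimeIter (zdBlocking d L) (bgT L U₀) j f y) ∧
          (∀ (f : Site d → 𝔸) (j : ℕ) (y : Site d), ¬ (j ≤ k ∧ y ∈ Λs k j) → q f j y = 0) ∧
          (∀ (X : XSpace d k 𝔸) (x : Site d), ‖H' X x‖ ≤ B₀'H * ‖X‖) ∧
          (∀ j, j ≤ k → ∀ (X : XSpace d k 𝔸), ∀ p ∈ {b : Site d × Fin d | SideTouches (Ω j) b.1 b.2},
            wt L η j * ‖covDerivFwd η U₀ p.2 (H' X) p.1‖ ≤ B₀'H * ‖X‖) ∧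
          (∀ X : XSpace d k 𝔸, Bd2 L η k Ω (covLap η U₀ (H' X)) (B₂' * ‖X‖)) ∧
          (∀ (Y : XSpace d k 𝔸) (j : ℕ) (hj : j ≤ k) (y : Site d), y ∈ Λs k j →
            QprimeIter (zdBlocking d L) (bgT L U₀) j (H' Y) y = Y (⟨j, Nat.lt_succ_of_le hj⟩, y)) ∧
          (∀ (f : Site d → 𝔸) (r : ℝ), 0 ≤ r → Bd2 L η k Ω f r →
            (∀ x, ‖g f x‖ ≤ BG * r) ∧ ∀ j, j ≤ k → ∀ p ∈ {b : Site d × Fin d | SideTouches (Ω j) b.1 b.2},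
              wt L η j * ‖covDerivFwd η U₀ p.2 (g f) p.1‖ ≤ BG * r) ∧
          (∀ (f : Site d → 𝔸) (r : ℝ), 0 ≤ r → Bd2 L η k Ω f r → Bd2 L η k Ω (f - g (qs (c (q (g f))))) (BR * r))) →
      ∀ {B₀β β : ℝ} {len : Site d → ℝ}, (∀ m, m ≤ k → SockB9P3 (𝔸 := 𝔸) L B₀ B₀β cB9 β len η m Ω Λs Λb) →
        SockP5uE (𝔸 := 𝔸) L B₀ cF cu η k Ω Λs := by
  have hd1 : 1 ≤ d := le_trans (by norm_num) hd2
  have hL1 : 1 ≤ L := le_trans (by norm_num) hL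
  obtain ⟨α₄, cu, cP, hα₄, hcu, hcP, hwin⟩ := uniqWindows_of_guard hd1 hL1 hB₀ hB hB₀'H hB₂' hBG hBR hcB9
  refine ⟨cu, min cP cL, hcu, lt_min hcP hcL, ?_⟩
  intro η hη k hk Ω hΩ hΩ0 Λs Λb hbox hclass htower SLetUB B₀β β len SB9all
  have hwin' : ∀ α₀ α₁ : ℝ, 0 < α₀ → 0 < α₁ → α₀ + α₁ ≤ min cP cL → _ :=
    fun α₀ α₁ hα₀ hα₁ hs => hwin α₀ α₁ hα₀ hα₁ (hs.trans (min_le_left _ _))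
  exact sockP5uE_of_lettersUB hd2 hL hη hk hΩ hΩ0 hbox hclass htower hB₀ hB₀'H hB₂' hBG hBR hα₄ SLetUB SB9all (min_le_right _ _) hwin'

#print axioms sockP5uE_body_of_join_b
#print axioms sockP5uE_of_lettersUB
#print axioms exists_threshold_sockP5uEB

end Literature.MathematicalPhysics.QuantumFieldTheory.Balaban1983to89.B8SockP5uEAssemblyB

end
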